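import Summits.HodgeConjecture.HodgeConjecture.Theorems.TropicalKugaSatakeCayleyEffectiveCayleyNonRealizabilityIdentityPrinciple
import Summits.HodgeConjecture.HodgeConjecture.Theorems.TropicalKugaSatakeCayleyFormalCycleCriterionFormalFamily
import Summits.HodgeConjecture.HodgeConjecture.Theorems.TropicalKugaSatakeCayleyFormalCycleCriterion
import HarnessLib

/-!
# Crux `EffectiveCayleyNonRealizability` (stmt-HodgeConjecture-18569), line `formal_rational` —
# registered stub 1 `stub_rationalFormalization`, PROVED: rational formalisation of Kontsevich's
# formal cycle

Route `TropicalKugaSatakeCayley` of `HodgeConjecture`. Stub 1 of the registered skeleton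
`Cruxes/EffectiveCayleyNonRealizability/Lines/formal_rational.lean`: if the period class `M` is
realised by effective tropical `2`-cycles of `ℝ⁸ / B_t ℤ⁸` (`B_t = ksMatrix t`) at every `t` of a
non-empty open `U ⊆ ksPosCone`, then some AFFINE-LINEAR formal framed chain `𝒵` over `ℚ[t₀,…,t₄]`
evaluates, at every `t` of a non-empty open `V ⊆ U`, to an effective tropical cycle of `ℝ⁸ / B_t ℤ⁸`
with period class `M` (Zharkov p. 3: cycles "which vary rationally over the space of parameters").

Proof (`rationalFormalization_general`). (1) `U` contains `t*` with algebraically independent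
coordinates (`exists_algebraicIndependent_mem`); let `Z` be the effective cycle of class `M` there.
(2) As in `FormalCycleCriterion.formalFamily`, the incidences of `Z` at `t*` read `A x = N t` on the
cell data (`A` rational, `N` integral), solved at `t*` by the data `x₀` of `Z`, hence by `G N t` at
every `t` (`G` a generalized inverse, `mulVec_section_of_linearIndependent`); every solution at `t` is
a cycle of `ℝ⁸ / B_t ℤ⁸` (`isCycle_of_incidences`). (3) `y₀ = x₀ - G N t* ∈ ker A`, and rational
points are dense in the real kernel of a rational matrix (`exists_rat_kernel_near`), so a rational
`y₁ ∈ ker A` is `δ`-close to `y₀` and `x(t) = y₁ + G N t` is a RATIONAL affine section, `δ`-close to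
`x₀` at `t*`; the formal chain has entries `C (y₁)_κ + Σ_s C (G N)_{κ s} X_s` (total degree `≤ 1`).
(4) Effectivity is open in the data: it holds at `x(t*)` and then on a ball `V ⊆ U` around `t*`.
(5) On `V` the period class of `x(t)` is continuous and rational-valued (`cycleClassRational`), hence
constant (`apply_eq_of_ratValued`); at `t*` it is `M` because the whole LINE `x₀ + s (x(t*) - x₀)`,
`s ∈ ℝ`, solves the system at `t*` — cycles of constant class, equal to that of `Z` at `s = 0`.

No named fact, no new definition, no sorry. The last theorem `rationalFormalization` is the
REGISTERED SIGNATURE with the skeleton-local `evalChain` / `evalCell` unfolded verbatim (the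
skeleton's `stub_rationalFormalization` is literally `rationalFormalization`).
References: [Zharkov2020TropicalWeil] I. Zharkov, arXiv:2002.02347, p. 3; [MikhalkinZharkov2014Eigenwave]
G. Mikhalkin, I. Zharkov, Tropical eigenwave and intermediate Jacobians, LN UMI 15 (2014), Prop. 4.3.
-/

noncomputable section

-- `Summit.HodgeConjecture.HodgeConjecture.…` is the mandated namespace (single-conjunct summit).
set_option linter.dupNamespace false

open scoped BigOperators Matrix

namespace Summit.HodgeConjecture.HodgeConjecture.Theorems.EffectiveCayleyNonRealizability

open Summit.HodgeConjecture.HodgeConjecture.Theorems.FormalCycleCriterion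

/-! ### Rational points of rational kernels -/

/-- Casting `P · z` (rational) to `ℝ` gives `P_ℝ · z_ℝ`. [folklore] -/
theorem ratCast_mulVec {ι κ : Type*} [Fintype κ] (P : Matrix ι κ ℚ) (z : κ → ℚ) :
    (fun i => ((P *ᵥ z) i : ℝ)) = P.map ((↑) : ℚ → ℝ) *ᵥ fun j => (z j : ℝ) := by
  funext i
  simp only [Matrix.mulVec, dotProduct, Matrix.map_apply, Rat.cast_sum, Rat.cast_mul]

/-- **Rational points are dense in the real kernel of a rational matrix.** If `A_ℝ y₀ = 0` then for
every `δ > 0` some rational `y₁ ∈ ker A` is `δ`-close to `y₀`: `y₁ = (1 - G A) z` for a generalized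
inverse `G` of `A` and a rational `z` close to `y₀` (`1 - G A` maps into `ker A`, fixes `y₀`). [folklore] -/
theorem exists_rat_kernel_near {ι : Type*} {κ : Type} [Fintype ι] [Fintype κ] [DecidableEq ι]
    [DecidableEq κ]
    (A : Matrix ι κ ℚ) (y₀ : κ → ℝ) (hy₀ : A.map ((↑) : ℚ → ℝ) *ᵥ y₀ = 0) {δ : ℝ} (hδ : 0 < δ) :
    ∃ y₁ : κ → ℚ, A *ᵥ y₁ = 0 ∧ dist (fun i => (y₁ i : ℝ)) y₀ < δ := by
  obtain ⟨G, hG⟩ := exists_generalizedInverse A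
  let P : Matrix κ κ ℚ := 1 - G * A
  have hAP : A * P = 0 := by
    simp only [P, Matrix.mul_sub, Matrix.mul_one, ← Matrix.mul_assoc, hG, sub_self]
  -- `P_ℝ` is continuous and fixes `y₀`
  have hPc : Continuous fun z : κ → ℝ => P.map ((↑) : ℚ → ℝ) *ᵥ z := continuous_mulVec_const _
  have hPy₀ : P.map ((↑) : ℚ → ℝ) *ᵥ y₀ = y₀ := by
    have e : P.map ((↑) : ℚ → ℝ) = 1 - G.map ((↑) : ℚ → ℝ) * A.map ((↑) : ℚ → ℝ) := by
      simp only [P, Matrix.map_sub ((↑) : ℚ → ℝ) Rat.cast_sub, map_ratCast_mul,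
        Matrix.map_one ((↑) : ℚ → ℝ) Rat.cast_zero Rat.cast_one]
    rw [e, Matrix.sub_mulVec, Matrix.one_mulVec, ← Matrix.mulVec_mulVec, hy₀, Matrix.mulVec_zero,
      sub_zero]
  -- a rational `z` close enough to `y₀`
  have hO : IsOpen ((fun z : κ → ℝ => P.map ((↑) : ℚ → ℝ) *ᵥ z) ⁻¹' Metric.ball y₀ δ) :=
    hPc.isOpen_preimage _ Metric.isOpen_ball
  obtain ⟨z, hz⟩ := exists_rat_mem hO ⟨y₀, by
    show P.map ((↑) : ℚ → ℝ) *ᵥ y₀ ∈ Metric.ball y₀ δ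
    rw [hPy₀]; exact Metric.mem_ball_self hδ⟩
  refine ⟨P *ᵥ z, by rw [Matrix.mulVec_mulVec, hAP, Matrix.zero_mulVec], ?_⟩
  rw [ratCast_mulVec]
  exact Metric.mem_ball.1 hz

/-! ### Affine-linear forms `C a + Σ_s C (b s) · X s` -/

/-- The affine-linear polynomial `a + Σ_s b_s t_s ∈ ℚ[t]` has total degree at most `1`. [folklore] -/
theorem totalDegree_affineForm_le {σ : Type*} [Fintype σ] (a : ℚ) (b : σ → ℚ) :
    (MvPolynomial.C a + ∑ s, MvPolynomial.C (b s) * MvPolynomial.X s : MvPolynomial σ ℚ).totalDegree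
      ≤ 1 := by
  refine (MvPolynomial.totalDegree_add _ _).trans (max_le ?_ ?_)
  · rw [MvPolynomial.totalDegree_C]; exact zero_le_one
  · refine (MvPolynomial.totalDegree_finsetSum _ _).trans (Finset.sup_le fun s _ => ?_)
    refine (MvPolynomial.totalDegree_mul _ _).trans ?_
    rw [MvPolynomial.totalDegree_C, zero_add]
    exact (MvPolynomial.isHomogeneous_X ℚ s).totalDegree_le

/-- Evaluation of the affine-linear polynomial at `t ∈ ℝ^σ`: `a + Σ_s b_s t_s`. [folklore] -/
theorem aeval_affineForm {σ : Type*} [Fintype σ] (t : σ → ℝ) (a : ℚ) (b : σ → ℚ) :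
    MvPolynomial.aeval t
        (MvPolynomial.C a + ∑ s, MvPolynomial.C (b s) * MvPolynomial.X s : MvPolynomial σ ℚ) =
      (a : ℝ) + ∑ s, (b s : ℝ) * t s := by
  simp only [map_add, map_sum, map_mul, MvPolynomial.aeval_C, MvPolynomial.aeval_X, eq_ratCast]

/-! ### The rational formalisation -/

section Main

open Literature.AlgebraicGeometry.Tropical
open Literature.AlgebraicGeometry.Tropical.TropicalTorus

open Classical in
/-- **Rational formalisation of Kontsevich's formal cycle** (general form of the registered stub).
If the period class `M` is realised by effective tropical `2`-cycles of `ℝ⁸ / B_t ℤ⁸` at every `t`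
of a non-empty open `U ⊆ ksPosCone`, then there is an AFFINE-LINEAR formal chain `𝒵` over
`ℚ[t₀,…,t₄]` and a non-empty open `V ⊆ U` such that at every `t ∈ V` the evaluation of `𝒵` is an
effective tropical cycle of `ℝ⁸ / B_t ℤ⁸` with period class `M`.
Construction: take `t* ∈ U` with algebraically independent coordinates and the cycle `Z` there; its
incidences form a rational linear system `A x = N t` in the cell data, solved at the `ℚ`-generic
`t*` by the data `x₀` of `Z`, hence (`G` a generalized inverse of `A`) by `G N t` at every `t`;
`y₀ = x₀ - G N t* ∈ ker A` has a RATIONAL `δ`-approximation `y₁ ∈ ker A`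
(`exists_rat_kernel_near`), and `x(t) = y₁ + G N t` is a rational affine section of the system
through a point `δ`-close to `x₀`. The formal chain has entries `C y₁ + Σ_s C (G N)_s X_s`. At every
`t` all incidences of `Z` persist (so the evaluation is a cycle, `isCycle_of_incidences`);
effectivity holds near `(x₀, t*)`; on a small ball `V` the period class is continuous and
rational-valued (`cycleClassRational`), hence constant, and at `t*` it equals `M` because the whole
LINE `x₀ + s (x(t*) - x₀)`, `s ∈ ℝ`, solves the system at `t*` (cycles with continuous rational-valued
class through `Z` at `s = 0`). [cite: Zharkov2020TropicalWeil, p. 3]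
[cite: MikhalkinZharkov2014Eigenwave, Prop. 4.3] -/
theorem rationalFormalization_general (U : Set (Fin 5 → ℝ)) (hUo : IsOpen U) (hUne : U.Nonempty)
    (hUcone : U ⊆ ksPosCone) (M : Matrix (Sub 8 2) (Sub 8 2) ℝ)
    (hU : ∀ t ∈ U, ∃ Z : Chain ℝ 8 2, Z.IsCycle (ksMatrix t) ∧ Z.Effective ∧
      compound 2 (ksMatrix t)⁻¹ * Z.classOf = M) :
    ∃ 𝒵 : Chain (MvPolynomial (Fin 5) ℚ) 8 2, 𝒵.IsAffineLinear ∧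
      ∃ V : Set (Fin 5 → ℝ), IsOpen V ∧ V.Nonempty ∧ V ⊆ U ∧
        ∀ t ∈ V,
          (⟨𝒵.size, fun c => ⟨fun r => MvPolynomial.aeval t ((𝒵.cell c).base r), (𝒵.cell c).dir,
              fun i j => MvPolynomial.aeval t ((𝒵.cell c).coef i j), (𝒵.cell c).weight⟩⟩ :
              Chain ℝ 8 2).IsCycle (ksMatrix t) ∧
          (⟨𝒵.size, fun c => ⟨fun r => MvPolynomial.aeval t ((𝒵.cell c).base r), (𝒵.cell c).dir,
              fun i j => MvPolynomial.aeval t ((𝒵.cell c).coef i j), (𝒵.cell c).weight⟩⟩ :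
              Chain ℝ 8 2).Effective ∧
          compound 2 (ksMatrix t)⁻¹ *
            (⟨𝒵.size, fun c => ⟨fun r => MvPolynomial.aeval t ((𝒵.cell c).base r), (𝒵.cell c).dir,
                fun i j => MvPolynomial.aeval t ((𝒵.cell c).coef i j), (𝒵.cell c).weight⟩⟩ :
                Chain ℝ 8 2).classOf = M := by
  classical
  -- a generic parameter `t ∈ U` and the effective cycle `Z` there
  obtain ⟨t, htU, htai⟩ := exists_algebraicIndependent_mem hUo hUne
  have hli : LinearIndependent ℚ t := htai.linearIndependent
  obtain ⟨Z, hZc, hZe, hZM⟩ := hU t htU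
  -- the incidences of `Z` at `t` and their period vectors `k`
  let S : Finset ((Fin Z.size × Fin Z.size) × (Fin 3 × Fin 3) ×
      (Equiv.Perm (Fin 2) × Equiv.Perm (Fin 2))) :=
    Finset.univ.filter fun q => IsTranslate (ksMatrix t)
      ((Z.cell q.1.1).face q.2.1.1 ∘ q.2.2.1) ((Z.cell q.1.2).face q.2.1.2 ∘ q.2.2.2)
  have hkex : ∀ q : S, ∃ kq : Fin 8 → ℤ, ∀ j,
      ((Z.cell q.1.1.2).face q.1.2.1.2 ∘ q.1.2.2.2) j =
        ((Z.cell q.1.1.1).face q.1.2.1.1 ∘ q.1.2.2.1) j +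
          (ksMatrix t).mulVec (fun r => (kq r : ℝ)) :=
    fun q => (Finset.mem_filter.1 q.2).2
  choose k hk using hkex
  -- cells from data vectors `x = (base_c, coef_c)_c`
  let mk : (Fin Z.size × (Fin 8 ⊕ Fin 2 × Fin 2) → ℝ) → Fin Z.size → Cell ℝ 8 2 := fun x c =>
    ⟨fun r => x (c, Sum.inl r), (Z.cell c).dir, Matrix.of fun i l => x (c, Sum.inr (i, l)),
      (Z.cell c).weight⟩
  let x₀ : Fin Z.size × (Fin 8 ⊕ Fin 2 × Fin 2) → ℝ := fun κ =>
    Sum.elim (fun r => (Z.cell κ.1).base r) (fun il => (Z.cell κ.1).coef il.1 il.2) κ.2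
  have hmk₀ : mk x₀ = Z.cell := by
    funext c
    rfl
  -- the rational matrices of the incidence system `A x = N t'`
  obtain ⟨V, hV⟩ := exists_vertexCoeff (n := Z.size) (g := 8) (fun c => (Z.cell c).dir)
    (fun c => (Z.cell c).weight)
  obtain ⟨Nc, hNc⟩ := exists_periodCoeff k
  let A : Matrix (S × Fin 2 × Fin 8) (Fin Z.size × (Fin 8 ⊕ Fin 2 × Fin 2)) ℚ :=
    Matrix.of fun e κ =>
      V e.1.1.1.2 (e.1.1.2.1.2.succAbove (e.1.1.2.2.2 e.2.1)) e.2.2 κ -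
        V e.1.1.1.1 (e.1.1.2.1.1.succAbove (e.1.1.2.2.1 e.2.1)) e.2.2 κ
  let N : Matrix (S × Fin 2 × Fin 8) (Fin 5) ℚ := Matrix.of fun e s => Nc e.1 e.2.2 s
  have hAx : ∀ (x : Fin Z.size × (Fin 8 ⊕ Fin 2 × Fin 2) → ℝ) (q : S) (j : Fin 2) (r : Fin 8),
      (A.map ((↑) : ℚ → ℝ)).mulVec x (q, j, r) =
        ((mk x q.1.1.2).face q.1.2.1.2 ∘ q.1.2.2.2) j r -
          ((mk x q.1.1.1).face q.1.2.1.1 ∘ q.1.2.2.1) j r := by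
    intro x q j r
    simp only [Matrix.mulVec, dotProduct, Matrix.map_apply, Matrix.of_apply, A, Rat.cast_sub,
      sub_mul, Finset.sum_sub_distrib, hV]
    rfl
  have hNx : ∀ (v : Fin 5 → ℝ) (q : S) (j : Fin 2) (r : Fin 8),
      (N.map ((↑) : ℚ → ℝ)).mulVec v (q, j, r) = (ksMatrix v).mulVec (fun r => (k q r : ℝ)) r := by
    intro v q j r
    simp only [Matrix.mulVec, dotProduct, Matrix.map_apply, Matrix.of_apply, N]
    exact hNc v q r
  -- the system holds at `t` for the data of `Z`
  have hx₀ : (A.map ((↑) : ℚ → ℝ)).mulVec x₀ = (N.map ((↑) : ℚ → ℝ)).mulVec t := by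
    funext e
    obtain ⟨q, j, r⟩ := e
    rw [hAx, hNx, hmk₀]
    have h := congr_fun (hk q j) r
    simp only [Pi.add_apply] at h
    linarith
  obtain ⟨G, hG⟩ := exists_generalizedInverse A
  have hsec : ∀ t', (A.map ((↑) : ℚ → ℝ)).mulVec (((G * N).map ((↑) : ℚ → ℝ)).mulVec t') =
      (N.map ((↑) : ℚ → ℝ)).mulVec t' := by
    intro t'
    rw [map_ratCast_mul, ← Matrix.mulVec_mulVec]
    exact mulVec_section_of_linearIndependent A G hG N t hli x₀ hx₀ t'
  -- INCIDENCES PERSIST along any solution of the system, hence the cycle condition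
  have hcyc_of_sol : ∀ (t' : Fin 5 → ℝ) (x : Fin Z.size × (Fin 8 ⊕ Fin 2 × Fin 2) → ℝ),
      (A.map ((↑) : ℚ → ℝ)).mulVec x = (N.map ((↑) : ℚ → ℝ)).mulVec t' →
        (⟨Z.size, mk x⟩ : Chain ℝ 8 2).IsCycle (ksMatrix t') := by
    intro t' x hsol
    refine isCycle_of_incidences Z.cell (mk x) (ksMatrix t) (ksMatrix t') (fun c => rfl) ?_ hZc
    intro c c' i i' π π' hinc
    let q : S := ⟨((c, c'), (i, i'), (π, π')), Finset.mem_filter.2 ⟨Finset.mem_univ _, hinc⟩⟩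
    refine ⟨k q, fun j => ?_⟩
    funext r
    have h := congr_fun hsol (q, j, r)
    rw [hAx, hNx] at h
    have h' : ((mk x c').face i' ∘ π') j r - ((mk x c).face i ∘ π) j r =
        (ksMatrix t').mulVec (fun r => (k q r : ℝ)) r := h
    rw [Pi.add_apply]
    linarith
  -- the class and the determinants are continuous in the data
  have hdetc : ∀ c : Fin Z.size, Continuous fun x : Fin Z.size × (Fin 8 ⊕ Fin 2 × Fin 2) → ℝ =>
      (Matrix.of fun i l => x (c, Sum.inr (i, l)) : Matrix (Fin 2) (Fin 2) ℝ).det :=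
    fun c => (continuous_matrix fun i l => continuous_apply (c, Sum.inr (i, l))).matrix_det
  have hclsc : Continuous fun x : Fin Z.size × (Fin 8 ⊕ Fin 2 × Fin 2) → ℝ =>
      (⟨Z.size, mk x⟩ : Chain ℝ 8 2).classOf := by
    show Continuous fun x => ∑ c : Fin Z.size, (mk x c).classOf
    refine continuous_finsetSum _ fun c _ => continuous_matrix fun K J => ?_
    show Continuous fun x : Fin Z.size × (Fin 8 ⊕ Fin 2 × Fin 2) → ℝ =>
      algebraMap ℚ ℝ (((Nat.factorial 2 : ℚ)⁻¹ *
        pluecker (Z.cell c).dir K) * ((Z.cell c).weight * pluecker (Z.cell c).dir J)) *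
          (Matrix.of fun i l => x (c, Sum.inr (i, l)) : Matrix (Fin 2) (Fin 2) ℝ).det
    exact continuous_const.mul (hdetc c)
  -- the effectivity locus in data space is open and contains `x₀`
  have hEo : IsOpen {x : Fin Z.size × (Fin 8 ⊕ Fin 2 × Fin 2) → ℝ | ∀ c : Fin Z.size,
      0 < ((Z.cell c).weight : ℝ) *
        (Matrix.of fun i l => x (c, Sum.inr (i, l)) : Matrix (Fin 2) (Fin 2) ℝ).det} := by
    rw [Set.setOf_forall]
    exact isOpen_iInter_of_finite fun c => isOpen_lt continuous_const (continuous_const.mul (hdetc c))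
  set E : Set (Fin Z.size × (Fin 8 ⊕ Fin 2 × Fin 2) → ℝ) := {x | ∀ c : Fin Z.size,
      0 < ((Z.cell c).weight : ℝ) *
        (Matrix.of fun i l => x (c, Sum.inr (i, l)) : Matrix (Fin 2) (Fin 2) ℝ).det} with hEdef
  have hx₀E : x₀ ∈ E := by
    rw [hEdef]
    exact fun c => hZe c
  have heff_of_mem : ∀ x ∈ E, (⟨Z.size, mk x⟩ : Chain ℝ 8 2).Effective := by
    intro x hx c
    rw [hEdef] at hx
    exact hx c
  obtain ⟨δ, hδ, hδE⟩ := Metric.isOpen_iff.1 hEo x₀ hx₀E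
  -- a RATIONAL point `y₁` of `ker A` close to `y₀ = x₀ - G N t`
  let y₀ : Fin Z.size × (Fin 8 ⊕ Fin 2 × Fin 2) → ℝ := x₀ - ((G * N).map ((↑) : ℚ → ℝ)).mulVec t
  have hy₀ : (A.map ((↑) : ℚ → ℝ)).mulVec y₀ = 0 := by
    show (A.map _).mulVec (x₀ - ((G * N).map _).mulVec t) = 0
    rw [Matrix.mulVec_sub, hx₀, hsec, sub_self]
  obtain ⟨y₁, hy₁A, hy₁δ⟩ := exists_rat_kernel_near A y₀ hy₀ hδ
  -- the rational affine section `x(t') = y₁ + G N t'`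
  let xs : (Fin 5 → ℝ) → Fin Z.size × (Fin 8 ⊕ Fin 2 × Fin 2) → ℝ := fun t' =>
    (fun κ => (y₁ κ : ℝ)) + ((G * N).map ((↑) : ℚ → ℝ)).mulVec t'
  have hy₁A' : (A.map ((↑) : ℚ → ℝ)).mulVec (fun κ => (y₁ κ : ℝ)) = 0 := by
    rw [← ratCast_mulVec, hy₁A]
    funext e
    simp
  have hsol : ∀ t', (A.map ((↑) : ℚ → ℝ)).mulVec (xs t') = (N.map ((↑) : ℚ → ℝ)).mulVec t' := by
    intro t'
    show (A.map _).mulVec ((fun κ => (y₁ κ : ℝ)) + ((G * N).map _).mulVec t') = _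
    rw [Matrix.mulVec_add, hy₁A', hsec, zero_add]
  have hxsc : Continuous xs := continuous_const.add (continuous_mulVec_const _)
  have hxst : dist (xs t) x₀ < δ := by
    have e : xs t - x₀ = (fun κ => (y₁ κ : ℝ)) - y₀ := by
      show ((fun κ => (y₁ κ : ℝ)) + ((G * N).map _).mulVec t) - x₀ =
        (fun κ => (y₁ κ : ℝ)) - (x₀ - ((G * N).map _).mulVec t)
      abel
    rw [dist_eq_norm, e, ← dist_eq_norm]
    exact hy₁δ
  -- THE FORMAL CHAIN with entries `C (y₁ κ) + Σ_s C ((G N) κ s) X_s`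
  let ℓ : (Fin Z.size × (Fin 8 ⊕ Fin 2 × Fin 2)) → MvPolynomial (Fin 5) ℚ := fun κ =>
    MvPolynomial.C (y₁ κ) + ∑ s, MvPolynomial.C ((G * N) κ s) * MvPolynomial.X s
  have hℓ : ∀ t' κ, MvPolynomial.aeval t' (ℓ κ) = xs t' κ := by
    intro t' κ
    show MvPolynomial.aeval t' (MvPolynomial.C (y₁ κ) + ∑ s, MvPolynomial.C ((G * N) κ s) *
      MvPolynomial.X s) = (y₁ κ : ℝ) + ((G * N).map ((↑) : ℚ → ℝ)).mulVec t' κ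
    rw [aeval_affineForm]
    simp only [Matrix.mulVec, dotProduct, Matrix.map_apply]
  let 𝒵 : Chain (MvPolynomial (Fin 5) ℚ) 8 2 :=
    ⟨Z.size, fun c => ⟨fun r => ℓ (c, Sum.inl r), (Z.cell c).dir, fun i j => ℓ (c, Sum.inr (i, j)),
      (Z.cell c).weight⟩⟩
  have heval : ∀ t', (⟨𝒵.size, fun c => ⟨fun r => MvPolynomial.aeval t' ((𝒵.cell c).base r),
      (𝒵.cell c).dir, fun i j => MvPolynomial.aeval t' ((𝒵.cell c).coef i j), (𝒵.cell c).weight⟩⟩ :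
      Chain ℝ 8 2) = ⟨Z.size, mk (xs t')⟩ := by
    intro t'
    show (⟨Z.size, fun c => ⟨fun r => MvPolynomial.aeval t' (ℓ (c, Sum.inl r)), (Z.cell c).dir,
      fun i j => MvPolynomial.aeval t' (ℓ (c, Sum.inr (i, j))), (Z.cell c).weight⟩⟩ : Chain ℝ 8 2) =
      ⟨Z.size, mk (xs t')⟩
    simp only [hℓ]
    rfl
  -- THE OPEN SET: a ball around `t` inside `U`, inside the effectivity locus of the section
  have hO : IsOpen (U ∩ xs ⁻¹' E) := hUo.inter (hxsc.isOpen_preimage _ hEo)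
  have htO : t ∈ U ∩ xs ⁻¹' E := ⟨htU, hδE hxst⟩
  obtain ⟨ε, hε, hball⟩ := Metric.isOpen_iff.1 hO t htO
  have hballcone : Metric.ball t ε ⊆ ksPosCone := fun t' ht' => hUcone (hball ht').1
  -- the period class along the section is continuous on the ball and rational-valued, so constant
  have hcont : ContinuousOn (fun t' => compound 2 (ksMatrix t')⁻¹ *
      (⟨Z.size, mk (xs t')⟩ : Chain ℝ 8 2).classOf) (Metric.ball t ε) := by
    intro t' ht'
    have hpd : (ksMatrix t').PosDef := hballcone ht'
    have hinv : ContinuousAt (fun t'' => (ksMatrix t'')⁻¹) t' := by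
      refine (continuousAt_matrix_inv (ksMatrix t') ?_).comp continuous_ksMatrix.continuousAt
      rw [Ring.inverse_eq_inv']
      exact continuousAt_inv₀ hpd.det_pos.ne'
    exact ((continuous_compound_two.continuousAt.comp hinv).mul
      (hclsc.comp hxsc).continuousAt).continuousWithinAt
  have hconst : ∀ t' ∈ Metric.ball t ε, compound 2 (ksMatrix t')⁻¹ *
      (⟨Z.size, mk (xs t')⟩ : Chain ℝ 8 2).classOf =
        compound 2 (ksMatrix t)⁻¹ * (⟨Z.size, mk (xs t)⟩ : Chain ℝ 8 2).classOf := by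
    intro t' ht'
    ext i j
    refine apply_eq_of_ratValued (g := fun s => (compound 2 (ksMatrix s)⁻¹ *
      (⟨Z.size, mk (xs s)⟩ : Chain ℝ 8 2).classOf) i j) (convex_ball t ε).isPreconnected ?_ ?_ ht'
      (Metric.mem_ball_self hε)
    · exact (continuous_apply_apply i j).comp_continuousOn hcont
    · intro s hs
      obtain ⟨Mq, hMq⟩ := cycleClassRational (ksMatrix s) (hballcone hs) _
        (hcyc_of_sol s (xs s) (hsol s))
      exact ⟨Mq i j, by rw [hMq]; rfl⟩
  -- at `t` the class is `M`: the LINE through `x₀` and `xs t` solves the system at `t`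
  have hline : compound 2 (ksMatrix t)⁻¹ * (⟨Z.size, mk (xs t)⟩ : Chain ℝ 8 2).classOf = M := by
    let xl : ℝ → Fin Z.size × (Fin 8 ⊕ Fin 2 × Fin 2) → ℝ := fun s => x₀ + s • (xs t - x₀)
    have hxl : ∀ s, (A.map ((↑) : ℚ → ℝ)).mulVec (xl s) = (N.map ((↑) : ℚ → ℝ)).mulVec t := by
      intro s
      show (A.map _).mulVec (x₀ + s • (xs t - x₀)) = _
      rw [Matrix.mulVec_add, Matrix.mulVec_smul, Matrix.mulVec_sub, hx₀, hsol, sub_self, smul_zero,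
        add_zero]
    have hxlc : Continuous xl := continuous_const.add (continuous_id.smul continuous_const)
    have key : ∀ i j, (compound 2 (ksMatrix t)⁻¹ * (⟨Z.size, mk (xl 1)⟩ : Chain ℝ 8 2).classOf) i j =
        (compound 2 (ksMatrix t)⁻¹ * (⟨Z.size, mk (xl 0)⟩ : Chain ℝ 8 2).classOf) i j := by
      intro i j
      refine apply_eq_of_ratValued (g := fun s => (compound 2 (ksMatrix t)⁻¹ *
        (⟨Z.size, mk (xl s)⟩ : Chain ℝ 8 2).classOf) i j) isPreconnected_univ ?_ ?_
        (Set.mem_univ 1) (Set.mem_univ 0)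
      · have hc : Continuous fun s => (compound 2 (ksMatrix t)⁻¹ *
            (⟨Z.size, mk (xl s)⟩ : Chain ℝ 8 2).classOf) i j :=
          (continuous_apply_apply i j).comp (continuous_const.mul (hclsc.comp hxlc))
        exact hc.continuousOn
      · intro s _
        obtain ⟨Mq, hMq⟩ := cycleClassRational (ksMatrix t) (hUcone htU) _
          (hcyc_of_sol t (xl s) (hxl s))
        exact ⟨Mq i j, by rw [hMq]; rfl⟩
    have h1 : xl 1 = xs t := by
      show x₀ + (1 : ℝ) • (xs t - x₀) = xs t
      rw [one_smul, add_sub_cancel]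
    have h0 : xl 0 = x₀ := by
      show x₀ + (0 : ℝ) • (xs t - x₀) = x₀
      rw [zero_smul, add_zero]
    rw [h1, h0, hmk₀] at key
    exact (Matrix.ext fun i j => key i j).trans hZM
  -- ASSEMBLY
  refine ⟨𝒵, fun c => ⟨fun r => totalDegree_affineForm_le _ _, fun i j =>
    totalDegree_affineForm_le _ _⟩, Metric.ball t ε, Metric.isOpen_ball, ⟨t, Metric.mem_ball_self hε⟩,
    fun t' ht' => (hball ht').1, fun t' ht' => ?_⟩
  rw [heval t']
  exact ⟨hcyc_of_sol t' (xs t') (hsol t'), heff_of_mem _ (hball ht').2, (hconst t' ht').trans hline⟩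

/-- **Registered stub `stub_rationalFormalization` of the line `formal_rational`** (crux
`EffectiveCayleyNonRealizability`, stmt-HodgeConjecture-18569) — the registered signature with the
skeleton-local `evalChain` / `evalCell` unfolded: open-effective realisability of `M` on `U` gives an
affine-linear formal chain over `ℚ[t₀,…,t₄]` whose evaluation is an effective tropical cycle of
`ℝ⁸ / B_t ℤ⁸` with period class `M` at every `t` of a non-empty open `V ⊆ U`.
[cite: Zharkov2020TropicalWeil, p. 3] [cite: MikhalkinZharkov2014Eigenwave, Prop. 4.3] -/
theorem rationalFormalization :
    ∀ U : Set (Fin 5 → ℝ), IsOpen U → U.Nonempty → U ⊆ ksPosCone →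
      ∀ M : Matrix (Sub 8 2) (Sub 8 2) ℝ,
        (∀ t ∈ U, ∃ Z : Chain ℝ 8 2, Z.IsCycle (ksMatrix t) ∧ Z.Effective ∧
          compound 2 (ksMatrix t)⁻¹ * Z.classOf = M) →
        ∃ 𝒵 : Chain (MvPolynomial (Fin 5) ℚ) 8 2, 𝒵.IsAffineLinear ∧
          ∃ V : Set (Fin 5 → ℝ), IsOpen V ∧ V.Nonempty ∧ V ⊆ U ∧
            ∀ t ∈ V,
              (⟨𝒵.size, fun c => ⟨fun r => MvPolynomial.aeval t ((𝒵.cell c).base r), (𝒵.cell c).dir,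
                  fun i j => MvPolynomial.aeval t ((𝒵.cell c).coef i j), (𝒵.cell c).weight⟩⟩ :
                  Chain ℝ 8 2).IsCycle (ksMatrix t) ∧
              (⟨𝒵.size, fun c => ⟨fun r => MvPolynomial.aeval t ((𝒵.cell c).base r),
                  (𝒵.cell c).dir, fun i j => MvPolynomial.aeval t ((𝒵.cell c).coef i j),
                  (𝒵.cell c).weight⟩⟩ : Chain ℝ 8 2).Effective ∧
              compound 2 (ksMatrix t)⁻¹ *
                (⟨𝒵.size, fun c => ⟨fun r => MvPolynomial.aeval t ((𝒵.cell c).base r),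
                    (𝒵.cell c).dir, fun i j => MvPolynomial.aeval t ((𝒵.cell c).coef i j),
                    (𝒵.cell c).weight⟩⟩ : Chain ℝ 8 2).classOf = M :=
  fun U hUo hUne hUcone M hU => rationalFormalization_general U hUo hUne hUcone M hU

end Main

end Summit.HodgeConjecture.HodgeConjecture.Theorems.EffectiveCayleyNonRealizability

end
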